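import Summits.NavierStokesRegularity.FunctionalMining.HsConvectionTrilinear
import HarnessLib

/-!
# FunctionalMining — the inertial rate `N_s` through three Sobolev energies, II: the split form

Search for candidate a priori estimates; no regularity claim. Cell `pub-nsfunc`, prove seat
(gen 12). In `sq_hsInertialRate_le_trilinear` (`HsConvectionTrilinear`) the whole weight `σ_s(k)` of
the inertial rate `N_s(v) = −2∫⟪(-Δ)^s v, (v·∇)v⟫` sits on the third factor of the lattice trilinear
estimate, which caps the usable range of orders at `s < 5/2` (the top energy `E_{t₃+2s}` has to stay
below `E_{s+1}` while `t₁ + t₂ < 3`). Here a part `σ_r(k)`, `0 ≤ r ≤ s`, of that weight is moved onto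
the two factors of the convective term by the lattice Leibniz rule
`σ_r(k) ≤ 4^r (σ_r(k−j) + σ_r(j))` (`fracSymbol_le_mul_add`; parallelogram bound
`|k|² ≤ 2|k−j|² + 2|j|²`), giving, for smooth zero-mean `v` on `T³` and ANY two admissible exponent
triples `tᵢ, tᵢ' < 3/2`, `∑ tᵢ = ∑ tᵢ' = 3/2`,

**`N_s(v)² ≤ C · (E_{t₁+1+2r} E_{t₂} E_{t₃+2s−2r} + E_{t₁'+1} E_{t₂'+2r} E_{t₃'+2s−2r})`**
(`sq_hsInertialRate_le_trilinear_split`).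

With `2r = s`, `(tᵢ) = (0, 3/2 − 1/(2s), 1/(2s))` and `(tᵢ') = (1/2 − 1/(2s), 1, 1/(2s))` both products
are `E_{s+1} E_{3/2−1/(2s)} E_{s+1/(2s)}`, and log-convexity of `t ↦ E_t` then closes
`HsProductionBound s C` for EVERY real `s > 1/2` — done in the companion file
`HsProductionBoundAllOrders` (`exists_hsProductionBound`, accepted p256291), not here. This is the
Fourier-majorant form of distributing the `s` derivatives of `(-Δ)^{s/2}((v·∇)v)` over the two
factors (no commutator and no cancellation are used).
-/

noncomputable section

open MeasureTheory Set Filter Topology Function UnitAddTorus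
open scoped InnerProductSpace RealInnerProductSpace ENNReal

namespace Summit.NavierStokesRegularity.FunctionalMining

open Literature.Analysis Literature.Analysis.FunctionSpaces Literature.Analysis.FluidPDE
open Literature.Analysis.FunctionSpaces.Torus Literature.Analysis.FluidPDE.Torus

variable {d : Type*} [Fintype d] [DecidableEq d]

/-! ## 1. The lattice Leibniz rule for the symbol -/

omit [DecidableEq d] in
/-- `σ_1(k) ≤ 4 max(σ_1(k−j), σ_1(j))` (parallelogram bound `|k|² ≤ 2|j|² + 2|k−j|²`). [folklore] -/
theorem fracSymbol_one_le_four_mul_max (k j : d → ℤ) :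
    fracSymbol 1 k ≤ 4 * max (fracSymbol 1 (k - j)) (fracSymbol 1 j) := by
  rw [fracSymbol_one, fracSymbol_one, fracSymbol_one]
  have hpar := Lattice.freqNormSq_le_two_mul_add k j
  have hπ : (0 : ℝ) ≤ 4 * Real.pi ^ 2 := by positivity
  have h1 : 4 * Real.pi ^ 2 * freqNormSq (k - j) ≤
      max (4 * Real.pi ^ 2 * freqNormSq (k - j)) (4 * Real.pi ^ 2 * freqNormSq j) := le_max_left _ _
  have h2 : 4 * Real.pi ^ 2 * freqNormSq j ≤
      max (4 * Real.pi ^ 2 * freqNormSq (k - j)) (4 * Real.pi ^ 2 * freqNormSq j) := le_max_right _ _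
  nlinarith [mul_le_mul_of_nonneg_left hpar hπ]

omit [DecidableEq d] in
/-- **Lattice Leibniz rule for the symbol**: `σ_r(k) ≤ 4^r (σ_r(k−j) + σ_r(j))` for `r ≥ 0` and all
frequencies `k, j` (`σ_r = σ_1^r` is monotone, `(4M)^r = 4^r M^r`, and `M^r ≤ σ_r(k−j) + σ_r(j)` for
`M = max(σ_1(k−j), σ_1(j))`). [folklore] -/
theorem fracSymbol_le_mul_add {r : ℝ} (hr : 0 ≤ r) (k j : d → ℤ) :
    fracSymbol r k ≤ (4 : ℝ) ^ r * (fracSymbol r (k - j) + fracSymbol r j) := by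
  set M := max (fracSymbol 1 (k - j)) (fracSymbol 1 j) with hM
  have hM0 : 0 ≤ M := le_max_of_le_left (fracSymbol_nonneg 1 (k - j))
  have hMr : M ^ r ≤ fracSymbol r (k - j) + fracSymbol r j := by
    rcases le_total (fracSymbol 1 (k - j)) (fracSymbol 1 j) with h | h
    · rw [hM, max_eq_right h, ← LatticeTrilinear.fracSymbol_eq_rpow]
      linarith [fracSymbol_nonneg r (k - j)]
    · rw [hM, max_eq_left h, ← LatticeTrilinear.fracSymbol_eq_rpow]
      linarith [fracSymbol_nonneg r j]
  calc fracSymbol r k = fracSymbol 1 k ^ r := LatticeTrilinear.fracSymbol_eq_rpow r k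
    _ ≤ (4 * M) ^ r := Real.rpow_le_rpow (fracSymbol_nonneg 1 k) (fracSymbol_one_le_four_mul_max k j) hr
    _ = (4 : ℝ) ^ r * M ^ r := Real.mul_rpow (by norm_num) hM0
    _ ≤ (4 : ℝ) ^ r * (fracSymbol r (k - j) + fracSymbol r j) :=
        mul_le_mul_of_nonneg_left hMr (Real.rpow_nonneg (by norm_num) r)

omit [DecidableEq d] in
/-- The split of the top weight, in `ℝ≥0∞`: `σ_s(k) ≤ 4^r (σ_r(k−j) + σ_r(j)) σ_{s−r}(k)` for
`0 ≤ r ≤ s` (`σ_s = σ_r σ_{s−r}` and the Leibniz rule). [folklore] -/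
theorem ofReal_fracSymbol_le_split {s r : ℝ} (hr : 0 ≤ r) (hrs : r ≤ s) (k j : d → ℤ) :
    ENNReal.ofReal (fracSymbol s k) ≤ ENNReal.ofReal ((4 : ℝ) ^ r) *
      (ENNReal.ofReal (fracSymbol r (k - j)) + ENNReal.ofReal (fracSymbol r j)) *
        ENNReal.ofReal (fracSymbol (s - r) k) := by
  have hsplit : fracSymbol s k = fracSymbol r k * fracSymbol (s - r) k := by
    conv_lhs => rw [show s = r + (s - r) by ring]
    exact fracSymbol_add hr (by linarith) k
  rw [hsplit, ENNReal.ofReal_mul (fracSymbol_nonneg r k),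
    ← ENNReal.ofReal_add (fracSymbol_nonneg _ _) (fracSymbol_nonneg _ _),
    ← ENNReal.ofReal_mul (Real.rpow_nonneg (by norm_num) r)]
  exact mul_le_mul' (ENNReal.ofReal_le_ofReal (fracSymbol_le_mul_add hr k j)) le_rfl

/-! ## 2. Weighted coefficient families and their energies -/

/-- `∑_m σ_t(m) (σ_a(m) ‖v̂(m)‖)² = ofReal (E_{t+2a}(v))` for a smooth zero-mean `v` and `t + 2a ≥ 0`
(`σ_t σ_a² = σ_{t+2a}` off the zero mode, which a zero-mean field does not see). [folklore] -/
theorem tsum_fracSymbol_mul_sq_weighted_eq {t a : ℝ} (h : 0 ≤ t + 2 * a)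
    {v : UnitAddTorus d → EuclideanSpace ℝ d} (hv : IsSmooth v) (h0 : HasZeroMean v) :
    ∑' m, ENNReal.ofReal (fracSymbol t m) *
        (ENNReal.ofReal (fracSymbol a m) * ‖mFourierCoeff (EuclideanSpace.complexify ∘ v) m‖ₑ) ^ 2 =
      ENNReal.ofReal (torusHsEnergy (t + 2 * a) v) := by
  have hcv0 : mFourierCoeff (EuclideanSpace.complexify ∘ v) 0 = 0 :=
    mFourierCoeff_complexify_eq_zero_of_hasZeroMean h0
  rw [ofReal_torusHsEnergy_eq_tsum h hv]
  have step : ∀ m, ENNReal.ofReal (fracSymbol t m) *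
      (ENNReal.ofReal (fracSymbol a m) * ‖mFourierCoeff (EuclideanSpace.complexify ∘ v) m‖ₑ) ^ 2 =
      ENNReal.ofReal (fracSymbol t m * fracSymbol a m ^ 2) *
        (1 * ‖mFourierCoeff (EuclideanSpace.complexify ∘ v) m‖ₑ ^ 2) := by
    intro m
    rw [mul_pow, ← ENNReal.ofReal_pow (fracSymbol_nonneg _ _), ENNReal.ofReal_mul (fracSymbol_nonneg _ _)]
    ring
  rw [tsum_congr step, tsum_ofReal_mul_congr_of_zero (ψ := fun m => fracSymbol (t + 2 * a) m) ?_ hcv0]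
  · exact tsum_congr fun m => by rw [one_mul]
  · intro m hm
    rw [LatticeTrilinear.fracSymbol_add_of_ne_zero hm, LatticeTrilinear.fracSymbol_eq_rpow a,
      LatticeTrilinear.fracSymbol_eq_rpow (2 * a), ← Real.rpow_natCast,
      ← Real.rpow_mul (fracSymbol_nonneg 1 m)]
    congr 2
    push_cast
    ring

omit [Fintype d] [DecidableEq d] in
/-- Collecting constants: `(ofReal a)² (ofReal b)² · 3 (ofReal x + ofReal y) = ofReal (3a²b²(x + y))` for
nonnegative reals. [folklore] -/
theorem ofReal_sq_mul_sq_mul_three_add {a b x y : ℝ} (ha : 0 ≤ a) (hb : 0 ≤ b) (hx : 0 ≤ x) (hy : 0 ≤ y) :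
    ENNReal.ofReal a ^ 2 * ENNReal.ofReal b ^ 2 * (3 * (ENNReal.ofReal x + ENNReal.ofReal y)) =
      ENNReal.ofReal (3 * a ^ 2 * b ^ 2 * (x + y)) := by
  rw [← ENNReal.ofReal_pow ha, ← ENNReal.ofReal_pow hb, ← ENNReal.ofReal_add hx hy,
    show (3 : ℝ≥0∞) = ENNReal.ofReal 3 by norm_num, ← ENNReal.ofReal_mul (by norm_num : (0 : ℝ) ≤ 3),
    ← ENNReal.ofReal_mul (pow_nonneg ha 2),
    ← ENNReal.ofReal_mul (mul_nonneg (pow_nonneg ha 2) (pow_nonneg hb 2))]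
  congr 1
  ring

/-! ## 3. The split trilinear bound of the inertial rate -/

/-- **`N_s(v)² ≤ C · (E_{t₁+1+2r} E_{t₂} E_{t₃+2s−2r} + E_{t₁'+1} E_{t₂'+2r} E_{t₃'+2s−2r})`** on a
three-dimensional torus, for every smooth zero-mean field `v`, whenever `tᵢ, tᵢ' < 3/2`,
`t₁ + t₂ + t₃ = t₁' + t₂' + t₃' = 3/2`, `s > 0`, `0 ≤ r ≤ s`, and the six energy orders are
nonnegative (`C` depends on the exponents only). Proof: `|N_s| ≤ 2d² ∑_k∑_j σ_{1/2}(k−j)‖v̂(k−j)‖ ‖v̂(j)‖ σ_s(k)‖v̂(k)‖`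
as in `sq_hsInertialRate_le_trilinear`; split `σ_s(k) ≤ 4^r(σ_r(k−j) + σ_r(j))σ_{s−r}(k)`
(`ofReal_fracSymbol_le_split`) and apply the lattice trilinear estimate
`LatticeTrilinear.sq_tsum_tsum_conv_mul_le` to each of the two resulting sums, with
`(a,b,c) = (σ_{r+1/2}‖v̂‖, ‖v̂‖, σ_{s−r}‖v̂‖)` at `(tᵢ)` and `(σ_{1/2}‖v̂‖, σ_r‖v̂‖, σ_{s−r}‖v̂‖)` at `(tᵢ')`.
[ours] -/
theorem sq_hsInertialRate_le_trilinear_split (hd : Fintype.card d = 3)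
    {t₁ t₂ t₃ t₁' t₂' t₃' : ℝ} (ht₁ : t₁ < 3 / 2) (ht₂ : t₂ < 3 / 2) (ht₃ : t₃ < 3 / 2)
    (hsum : t₁ + t₂ + t₃ = 3 / 2) (ht₁' : t₁' < 3 / 2) (ht₂' : t₂' < 3 / 2) (ht₃' : t₃' < 3 / 2)
    (hsum' : t₁' + t₂' + t₃' = 3 / 2) {s r : ℝ} (hs : 0 < s) (hr : 0 ≤ r) (hrs : r ≤ s)
    (h₁ : 0 ≤ t₁ + 1 + 2 * r) (h₂ : 0 ≤ t₂) (h₃ : 0 ≤ t₃ + 2 * s - 2 * r)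
    (h₁' : 0 ≤ t₁' + 1) (h₂' : 0 ≤ t₂' + 2 * r) (h₃' : 0 ≤ t₃' + 2 * s - 2 * r) :
    ∃ C : ℝ, 0 ≤ C ∧ ∀ v : UnitAddTorus d → EuclideanSpace ℝ d, IsSmooth v → HasZeroMean v →
      hsInertialRate s v ^ 2 ≤
        C * (torusHsEnergy (t₁ + 1 + 2 * r) v * torusHsEnergy t₂ v * torusHsEnergy (t₃ + 2 * s - 2 * r) v +
          torusHsEnergy (t₁' + 1) v * torusHsEnergy (t₂' + 2 * r) v *
            torusHsEnergy (t₃' + 2 * s - 2 * r) v) := by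
  obtain ⟨K, hK, hT⟩ := LatticeTrilinear.sq_tsum_tsum_conv_mul_le hd ht₁ ht₂ ht₃ hsum
  obtain ⟨K', hK', hT'⟩ := LatticeTrilinear.sq_tsum_tsum_conv_mul_le hd ht₁' ht₂' ht₃' hsum'
  refine ⟨3 * (2 * (Fintype.card d : ℝ) ^ 2) ^ 2 * ((4 : ℝ) ^ r) ^ 2 * (K + K'), by positivity,
    fun v hv h0 => ?_⟩
  have h4r : (0 : ℝ) ≤ (4 : ℝ) ^ r := Real.rpow_nonneg (by norm_num) r
  -- names
  set cv : (d → ℤ) → EuclideanSpace ℂ d := fun m => mFourierCoeff (EuclideanSpace.complexify ∘ v) m with hcv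
  set cw : (d → ℤ) → EuclideanSpace ℂ d :=
    fun m => mFourierCoeff (EuclideanSpace.complexify ∘ Torus.convect v v) m with hcw
  have hcv0 : cv 0 = 0 := mFourierCoeff_complexify_eq_zero_of_hasZeroMean h0
  set a₁ : (d → ℤ) → ℝ≥0∞ := fun m => ENNReal.ofReal (fracSymbol (1 / 2) m) * ‖cv m‖ₑ with ha₁
  set a₂ : (d → ℤ) → ℝ≥0∞ := fun m => ‖cv m‖ₑ with ha₂
  set a₃ : (d → ℤ) → ℝ≥0∞ := fun m => ENNReal.ofReal (fracSymbol s m) * ‖cv m‖ₑ with ha₃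
  set aA : (d → ℤ) → ℝ≥0∞ := fun m => ENNReal.ofReal (fracSymbol (r + 1 / 2) m) * ‖cv m‖ₑ with haA
  set bB : (d → ℤ) → ℝ≥0∞ := fun m => ENNReal.ofReal (fracSymbol r m) * ‖cv m‖ₑ with hbB
  set cC : (d → ℤ) → ℝ≥0∞ := fun m => ENNReal.ofReal (fracSymbol (s - r) m) * ‖cv m‖ₑ with hcC
  have ha₂0 : a₂ 0 = 0 := by simp [ha₂, hcv0]
  have haA0 : aA 0 = 0 := by simp [haA, hcv0]
  have hbB0 : bB 0 = 0 := by simp [hbB, hcv0]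
  have hcC0 : cC 0 = 0 := by simp [hcC, hcv0]
  have ha₁0 : a₁ 0 = 0 := by simp [ha₁, hcv0]
  set T : ℝ≥0∞ := ∑' k : d → ℤ, ∑' j : d → ℤ, a₁ (k - j) * a₂ j * a₃ k with hTdef
  set TA : ℝ≥0∞ := ∑' k : d → ℤ, ∑' j : d → ℤ, aA (k - j) * a₂ j * cC k with hTAdef
  set TB : ℝ≥0∞ := ∑' k : d → ℤ, ∑' j : d → ℤ, a₁ (k - j) * bB j * cC k with hTBdef
  set EA₁ := torusHsEnergy (t₁ + 1 + 2 * r) v with hEA₁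
  set EA₂ := torusHsEnergy t₂ v with hEA₂
  set EA₃ := torusHsEnergy (t₃ + 2 * s - 2 * r) v with hEA₃
  set EB₁ := torusHsEnergy (t₁' + 1) v with hEB₁
  set EB₂ := torusHsEnergy (t₂' + 2 * r) v with hEB₂
  set EB₃ := torusHsEnergy (t₃' + 2 * s - 2 * r) v with hEB₃
  have hEA₁0 : 0 ≤ EA₁ := torusHsEnergy_nonneg h₁ hv
  have hEA₂0 : 0 ≤ EA₂ := torusHsEnergy_nonneg h₂ hv
  have hEA₃0 : 0 ≤ EA₃ := torusHsEnergy_nonneg h₃ hv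
  have hEB₁0 : 0 ≤ EB₁ := torusHsEnergy_nonneg h₁' hv
  have hEB₂0 : 0 ≤ EB₂ := torusHsEnergy_nonneg h₂' hv
  have hEB₃0 : 0 ≤ EB₃ := torusHsEnergy_nonneg h₃' hv
  -- ### (i) `ofReal |N_s| ≤ 2 d² T`
  have hN : ENNReal.ofReal |hsInertialRate s v| ≤ 2 * ((Fintype.card d : ℝ≥0∞) ^ 2 * T) := by
    have hP := ofReal_abs_integral_inner_fracLaplacian_convect_le hs.le hv
    unfold hsInertialRate
    rw [abs_mul, abs_neg, abs_two, ENNReal.ofReal_mul zero_le_two, ENNReal.ofReal_ofNat]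
    refine mul_le_mul' le_rfl (hP.trans ?_)
    calc ∑' k, ENNReal.ofReal (fracSymbol s k) * ‖cw k‖ₑ * ‖cv k‖ₑ
        ≤ ∑' k, ENNReal.ofReal (fracSymbol s k) * ((Fintype.card d : ℝ≥0∞) ^ 2 *
            ∑' j, ENNReal.ofReal (fracSymbol (1 / 2) (k - j)) * ‖cv (k - j)‖ₑ * ‖cv j‖ₑ) * ‖cv k‖ₑ :=
          ENNReal.tsum_le_tsum fun k => mul_le_mul' (mul_le_mul' le_rfl (enorm_mFourierCoeff_convect_le hv k)) le_rfl
      _ = (Fintype.card d : ℝ≥0∞) ^ 2 * T := by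
          rw [hTdef, ← ENNReal.tsum_mul_left]
          refine tsum_congr fun k => ?_
          rw [ENNReal.tsum_mul_right]
          simp only [ha₁, ha₂, ha₃]
          ring
  have hN' : ENNReal.ofReal |hsInertialRate s v| ≤ ENNReal.ofReal (2 * (Fintype.card d : ℝ) ^ 2) * T := by
    calc ENNReal.ofReal |hsInertialRate s v| ≤ 2 * ((Fintype.card d : ℝ≥0∞) ^ 2 * T) := hN
      _ = ENNReal.ofReal (2 * (Fintype.card d : ℝ) ^ 2) * T := by
          rw [ENNReal.ofReal_mul zero_le_two, ENNReal.ofReal_ofNat, ENNReal.ofReal_pow (Nat.cast_nonneg _),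
            ENNReal.ofReal_natCast, mul_assoc]
  -- ### (ii) the split `T ≤ 4^r (TA + TB)`
  have hpt : ∀ k j, a₁ (k - j) * a₂ j * a₃ k ≤
      ENNReal.ofReal ((4 : ℝ) ^ r) * (aA (k - j) * a₂ j * cC k + a₁ (k - j) * bB j * cC k) := by
    intro k j
    have hσ := ofReal_fracSymbol_le_split hr hrs k j
    simp only [ha₁, ha₂, ha₃, haA, hbB, hcC]
    rw [fracSymbol_add hr (by norm_num : (0 : ℝ) ≤ 1 / 2) (k - j), ENNReal.ofReal_mul (fracSymbol_nonneg _ _)]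
    refine le_trans (mul_le_mul' le_rfl (mul_le_mul' hσ le_rfl)) (le_of_eq ?_)
    ring
  have hsplitT : T ≤ ENNReal.ofReal ((4 : ℝ) ^ r) * (TA + TB) := by
    calc T = ∑' k, ∑' j, a₁ (k - j) * a₂ j * a₃ k := rfl
      _ ≤ ∑' k, ∑' j, ENNReal.ofReal ((4 : ℝ) ^ r) * (aA (k - j) * a₂ j * cC k + a₁ (k - j) * bB j * cC k) :=
          ENNReal.tsum_le_tsum fun k => ENNReal.tsum_le_tsum fun j => hpt k j
      _ = ENNReal.ofReal ((4 : ℝ) ^ r) * (TA + TB) := by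
          rw [hTAdef, hTBdef, ← ENNReal.tsum_add, ← ENNReal.tsum_mul_left]
          refine tsum_congr fun k => ?_
          rw [← ENNReal.tsum_add, ← ENNReal.tsum_mul_left]
  -- ### (iii) the trilinear estimate on each piece
  have eA₁ : ∑' m, ENNReal.ofReal (fracSymbol t₁ m) * aA m ^ 2 = ENNReal.ofReal EA₁ := by
    simp only [haA]
    have e := tsum_fracSymbol_mul_sq_weighted_eq (t := t₁) (a := r + 1 / 2) (by linarith) hv h0
    rw [show t₁ + 2 * (r + 1 / 2) = t₁ + 1 + 2 * r by ring] at e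
    exact e
  have eA₂ : ∑' m, ENNReal.ofReal (fracSymbol t₂ m) * a₂ m ^ 2 = ENNReal.ofReal EA₂ := by
    rw [hEA₂, ofReal_torusHsEnergy_eq_tsum h₂ hv]
  have eA₃ : ∑' m, ENNReal.ofReal (fracSymbol t₃ m) * cC m ^ 2 = ENNReal.ofReal EA₃ := by
    simp only [hcC]
    have e := tsum_fracSymbol_mul_sq_weighted_eq (t := t₃) (a := s - r) (by linarith) hv h0
    rw [show t₃ + 2 * (s - r) = t₃ + 2 * s - 2 * r by ring] at e
    exact e
  have eB₁ : ∑' m, ENNReal.ofReal (fracSymbol t₁' m) * a₁ m ^ 2 = ENNReal.ofReal EB₁ := by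
    simp only [ha₁]
    have e := tsum_fracSymbol_mul_sq_weighted_eq (t := t₁') (a := 1 / 2) (by linarith) hv h0
    rw [show t₁' + 2 * (1 / 2 : ℝ) = t₁' + 1 by ring] at e
    exact e
  have eB₂ : ∑' m, ENNReal.ofReal (fracSymbol t₂' m) * bB m ^ 2 = ENNReal.ofReal EB₂ := by
    simp only [hbB]
    exact tsum_fracSymbol_mul_sq_weighted_eq (t := t₂') (a := r) h₂' hv h0
  have eB₃ : ∑' m, ENNReal.ofReal (fracSymbol t₃' m) * cC m ^ 2 = ENNReal.ofReal EB₃ := by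
    simp only [hcC]
    have e := tsum_fracSymbol_mul_sq_weighted_eq (t := t₃') (a := s - r) (by linarith) hv h0
    rw [show t₃' + 2 * (s - r) = t₃' + 2 * s - 2 * r by ring] at e
    exact e
  have hTA : TA ^ 2 ≤ ENNReal.ofReal (K * (EA₁ * EA₂ * EA₃)) := by
    have h := hT aA a₂ cC haA0 ha₂0 hcC0
    rw [eA₁, eA₂, eA₃] at h
    refine h.trans_eq ?_
    rw [← ENNReal.ofReal_mul hK, ← ENNReal.ofReal_mul (mul_nonneg hK hEA₁0),
      ← ENNReal.ofReal_mul (mul_nonneg (mul_nonneg hK hEA₁0) hEA₂0)]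
    congr 1
    ring
  have hTB : TB ^ 2 ≤ ENNReal.ofReal (K' * (EB₁ * EB₂ * EB₃)) := by
    have h := hT' a₁ bB cC ha₁0 hbB0 hcC0
    rw [eB₁, eB₂, eB₃] at h
    refine h.trans_eq ?_
    rw [← ENNReal.ofReal_mul hK', ← ENNReal.ofReal_mul (mul_nonneg hK' hEB₁0),
      ← ENNReal.ofReal_mul (mul_nonneg (mul_nonneg hK' hEB₁0) hEB₂0)]
    congr 1
    ring
  -- ### (iv) assemble in `ℝ≥0∞` and return to `ℝ`
  have h3 : (TA + TB) ^ 2 ≤ 3 * (TA ^ 2 + TB ^ 2) := by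
    have h := Literature.Analysis.FunctionSpaces.ENNReal.add_three_sq_le TA TB 0
    simpa using h
  have hPA : 0 ≤ K * (EA₁ * EA₂ * EA₃) := by positivity
  have hPB : 0 ≤ K' * (EB₁ * EB₂ * EB₃) := by positivity
  have hfin : ENNReal.ofReal (hsInertialRate s v ^ 2) ≤
      ENNReal.ofReal (3 * (2 * (Fintype.card d : ℝ) ^ 2) ^ 2 * ((4 : ℝ) ^ r) ^ 2 *
        (K * (EA₁ * EA₂ * EA₃) + K' * (EB₁ * EB₂ * EB₃))) := by
    calc ENNReal.ofReal (hsInertialRate s v ^ 2) = ENNReal.ofReal |hsInertialRate s v| ^ 2 := by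
          rw [← ENNReal.ofReal_pow (abs_nonneg _), sq_abs]
      _ ≤ (ENNReal.ofReal (2 * (Fintype.card d : ℝ) ^ 2) * T) ^ 2 := pow_le_pow_left' hN' 2
      _ ≤ (ENNReal.ofReal (2 * (Fintype.card d : ℝ) ^ 2) * (ENNReal.ofReal ((4 : ℝ) ^ r) * (TA + TB))) ^ 2 :=
          pow_le_pow_left' (mul_le_mul' le_rfl hsplitT) 2
      _ = ENNReal.ofReal (2 * (Fintype.card d : ℝ) ^ 2) ^ 2 * ENNReal.ofReal ((4 : ℝ) ^ r) ^ 2 *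
            (TA + TB) ^ 2 := by ring
      _ ≤ ENNReal.ofReal (2 * (Fintype.card d : ℝ) ^ 2) ^ 2 * ENNReal.ofReal ((4 : ℝ) ^ r) ^ 2 *
            (3 * (TA ^ 2 + TB ^ 2)) := mul_le_mul' le_rfl h3
      _ ≤ ENNReal.ofReal (2 * (Fintype.card d : ℝ) ^ 2) ^ 2 * ENNReal.ofReal ((4 : ℝ) ^ r) ^ 2 *
            (3 * (ENNReal.ofReal (K * (EA₁ * EA₂ * EA₃)) + ENNReal.ofReal (K' * (EB₁ * EB₂ * EB₃)))) :=
          mul_le_mul' le_rfl (mul_le_mul' le_rfl (add_le_add hTA hTB))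
      _ = _ := ofReal_sq_mul_sq_mul_three_add (by positivity) h4r hPA hPB
  have hreal := (ENNReal.ofReal_le_ofReal_iff (by positivity)).1 hfin
  refine hreal.trans ?_
  have hKK : K * (EA₁ * EA₂ * EA₃) + K' * (EB₁ * EB₂ * EB₃) ≤ (K + K') * (EA₁ * EA₂ * EA₃ + EB₁ * EB₂ * EB₃) := by
    nlinarith [mul_nonneg hK (mul_nonneg (mul_nonneg hEB₁0 hEB₂0) hEB₃0),
      mul_nonneg hK' (mul_nonneg (mul_nonneg hEA₁0 hEA₂0) hEA₃0)]
  calc 3 * (2 * (Fintype.card d : ℝ) ^ 2) ^ 2 * ((4 : ℝ) ^ r) ^ 2 * (K * (EA₁ * EA₂ * EA₃) + K' * (EB₁ * EB₂ * EB₃))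
      ≤ 3 * (2 * (Fintype.card d : ℝ) ^ 2) ^ 2 * ((4 : ℝ) ^ r) ^ 2 *
          ((K + K') * (EA₁ * EA₂ * EA₃ + EB₁ * EB₂ * EB₃)) := mul_le_mul_of_nonneg_left hKK (by positivity)
    _ = _ := by ring

end Summit.NavierStokesRegularity.FunctionalMining
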